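import Summits.Ventures.AbcSig.Rows.BridgeC2c
import Summits.Ventures.AbcSig.Rows.C2cL29

/-!
# Venture AbcSig — CELL `C2cL29`: p1's census predicate `Rows.C2cCell 29 {17}` from the C2c row (exponent reduction by `Rows/BridgeC2c.lean`)

HONEST FRAMING. COMPUTATION cell `pub-abcsig`; CONDITIONAL theorem; no claim on ABC or any summit. Hypotheses exactly as in
`Rows/C2cL29.lean`: `BS04Package` (CITED), `DataComplete 7424` / `RefinesCPSymAll 7424` (COMPUTED; norm-form certificates), the row's per-orbit
CITED exclusions universally quantified in `n` and `m`. Conclusion = the conjunct `Rows.C2cCell 29 {17}` of p1's `C2Part2Signed` /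
`C2Part2bSigned` (`Rows/Statements.lean`; row of record `census/rows/C2a/C2c-l29.md`): ALL `m ≥ 1` with `n ∤ m` and all
coprime distributions `A·B = 29^m` — obtained from the reduced rows (`m < n`) by `C2cCell_of_rows` (m ↦ m mod n, y ↦ ℓ^q·y).
-/

namespace Summit.Ventures.AbcSig

/-- Cell `C2cL29`: `Rows.C2cCell 29 {17}` under the row's hypotheses. -/
theorem xcell_C2cL29 (M : NewformModel) (hP : M.BS04Package)
    (hD7424 : M.DataComplete 7424 level7424Orbits) (hCP7424 : M.RefinesCPSymAll 7424 level7424CP)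
    (hX_orbit_7424_9 : ∀ n m : ℕ, n ∈ ([13] : List ℕ) → M.Excludes 7424 orbit_7424_9 (famC2c 29 m n))
    (hX_orbit_7424_10 : ∀ n m : ℕ, n ∈ ([13] : List ℕ) → M.Excludes 7424 orbit_7424_10 (famC2c 29 m n)) :
    Rows.C2cCell 29 {17} :=
  C2cCell_of_rows 29 (by norm_num) (by norm_num) _
    (fun n hn h11 hnℓ hR m hm hmn x y z h1 h2 =>
      xrow_C2cL29 M hP hD7424 hCP7424 n hn h11 hnℓ (by intro hmem; simp only [List.mem_cons, List.not_mem_nil, or_false] at hmem; subst hmem; simp at hR) m hm hmn (hX_orbit_7424_9 n m) (hX_orbit_7424_10 n m) x y z h1 h2)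

end Summit.Ventures.AbcSig
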